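import Mathlib
import Literature.Analysis.FluidPDE.Tao2016AveragedNS.RenormalisedCascadeWaves
import Literature.Analysis.FluidPDE.Tao2016AveragedNS.SelfSimilarCascadeBlowup
import Literature.Analysis.FluidPDE.Tao2016AveragedNS.ViscousEternalSolutions
import Literature.Analysis.FluidPDE.Tao2016AveragedNS.BoundedEternalSolutions
import Summits.NavierStokesRegularity.NavierStokesRegularity.Theses.TaoLadderRungTwoBreak
import Summits.NavierStokesRegularity.NavierStokesRegularity.Theorems.TaoLadderRungTwoBreakNoSurvivingEternalViscBddOneWakeDyadicClassical
import Summits.NavierStokesRegularity.NavierStokesRegularity.Theorems.WakeRatchetAdmissibleEternalBoundCritical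
import Summits.NavierStokesRegularity.NavierStokesRegularity.Theorems.WakeRatchetAdmissibleEternalBoundTerminal
import Summits.NavierStokesRegularity.NavierStokesRegularity.Theorems.WakeRatchetAdmissibleEternalBoundDyadic

/-!
# Crux `TaoLadderRungTwoBreak.NoSurvivingEternalViscBddOne` (stmt-NavierStokesRegularity-20419):
# the DYADIC MEMBER of the viscous half (ρ+) `NoLoudLadderOne` follows from a CLASSICAL statement about
# ancient solutions of the VISCOUS Katz–Pavlović chain in critical variables

MODEL lattice ODEs only (Tao 2016 §1.2, §4, §6.4); nothing in this file is a statement about the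
Navier–Stokes equations, and no stub, crux, rung or summit is proved by it.

Companion of `…WakeDyadicClassical` (inviscid half).  For an admissible eternal solution of the dyadic member
with covariant viscosity `ν̂ > 0` (`IsEternalVisc ε₀ ν̂ dyadicTable W`) the critical scalar variable
`V_n(t) = (-t)⁻¹ W_n(-log(-t))₀ = Λ^n X_n(t)` solves the viscous Katz–Pavlović chain with a CONSTANT-IN-TIME,
shell-dependent viscosity (tree `hasDerivAt_crit_visc`; the grading of the nonlinearity disappears):

  `V̇_n = Λ V_{n-1}² − Λ⁻¹ V_n V_{n+1} − ν̂ (1+ε₀)^{2n} V_n`   on `t < 0`      (vKP-crit)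

(`dyadic_crit_hasDerivAt_visc`), with uniformly integrable shells, shells bounded near `0⁻`, and the LOUDNESS
hypothesis of `NoLoudLadder` reading `sup_{t<0} (1+ε₀)^{-4n} V_n(t)² ≥ ν̂²/4096` for every shell `n ≥ 0` — every
shell beats its own dissipation scale at some time: an ANCIENT BLOW-UP PROFILE of the viscous chain at base `Λ`.
Hence (`dyadic_noLoudLadder_of_classical`, threshold form `dyadic_noLoudLadder_slice_of_classical`):

**CLASSICAL FORM (ρ+, dyadic).**  If for every `ν̂ > 0` the viscous chain (vKP-crit) has NO real ancient solution
with uniformly integrable shells, shells bounded near `0⁻` and every shell `n ≥ 0` loud, then `NoLoudLadder`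
holds on the dyadic member at that `ε₀` (vacuously: no loud ladder exists).  This is the ancient-solution /
Leray-profile form of «the viscous dyadic model at base `Λ = (1+ε₀)^{5/2}`, dissipation degree `α = 2/5`, does not
blow up» — in print only for base `2^{5/2}` (Barbato–Morandin–Romito 2011; tree audit of `DyadicCascadeRegularity`);
positivity and the type-I bound may again be assumed for free (`dyadic_nonneg`, `norm_le_dyadic_visc`).

HONEST LABEL: dictionary work; the classical statement is OPEN at the route's bases; crux ⟨20419⟩, its children
and every NS statement remain OPEN.
-/

noncomputable section

-- the summit and its single sub-problem share the name (CONVENTIONS §1)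
set_option linter.dupNamespace false

namespace Summit.NavierStokesRegularity.NavierStokesRegularity.Theorems.NoSurvivingEternalViscBddOne.WakeCriterion

open Filter Topology Set MeasureTheory
open Literature.Analysis.FluidPDE Literature.Analysis.FluidPDE.TaoCascade
open Summit.NavierStokesRegularity.NavierStokesRegularity.Theses.TaoLadderRungTwoBreak
open Summit.NavierStokesRegularity.NavierStokesRegularity.Theorems.WakeRatchetCritical
  (hasDerivAt_negLogNeg hasDerivAt_invNeg integral_crit_eq)
open Summit.NavierStokesRegularity.NavierStokesRegularity.Theorems.WakeRatchetTerminal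
  (exists_norm_crit_le)
open Summit.NavierStokesRegularity.NavierStokesRegularity.Theorems.WakeRatchetDyadic
  (dyadic_hasDerivAt_apply dyadic_apply_ne_zero dyadic_nonneg)

variable {ε₀ νh : ℝ} {W : ℤ → ℝ → Em 4}

/-- **(vKP-crit) for the critical scalar variable, any covariant viscosity `ν̂ ≥ 0`.**  For an admissible
eternal solution of the dyadic member, `V_n(t) = (-t)⁻¹ W_n(-log(-t))₀` solves
`V̇_n = ΛV_{n-1}² − Λ⁻¹V_nV_{n+1} − ν̂(1+ε₀)^{2n}V_n` on `t < 0` (constant viscosity coefficient per shell).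
[cite: Tao2016AveragedNS, §1.2 (dyadic system), §4 (the viscous equation before Thm. 4.2), §6.4; tree `dyadic_hasDerivAt_apply`, `hasDerivAt_crit_visc`] -/
theorem dyadic_crit_hasDerivAt_visc (hW : IsEternalVisc ε₀ νh dyadicTable W) (n : ℤ) {t : ℝ} (ht : t < 0) :
    HasDerivAt (fun s : ℝ => (-s)⁻¹ * W n (-Real.log (-s)) 0)
      (bigLam ε₀ * ((-t)⁻¹ * W (n - 1) (-Real.log (-t)) 0) ^ 2
        - (bigLam ε₀)⁻¹ * (((-t)⁻¹ * W n (-Real.log (-t)) 0)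
            * ((-t)⁻¹ * W (n + 1) (-Real.log (-t)) 0))
        - νh * (1 + ε₀) ^ ((2 : ℝ) * n) * ((-t)⁻¹ * W n (-Real.log (-t)) 0)) t := by
  have hnt : 0 < -t := neg_pos.2 ht
  have hw := dyadic_hasDerivAt_apply hW n (-Real.log (-t)) 0
  rw [if_pos rfl] at hw
  have hvc : viscCoef ε₀ νh n (-Real.log (-t)) = νh * ((1 + ε₀) ^ ((2 : ℝ) * n) * (-t)) := by
    unfold viscCoef
    rw [neg_neg, Real.exp_log hnt]
  rw [hvc] at hw
  have hcomp := hw.scomp t (hasDerivAt_negLogNeg ht)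
  have hprod := (hasDerivAt_invNeg ht).smul hcomp
  refine hprod.congr_deriv ?_
  simp only [Function.comp_apply, smul_eq_mul]
  field_simp
  ring

/-- The action clause in critical variables, any `ν̂ ≥ 0`.
[cite: Tao2016AveragedNS, §6.4; tree `integral_crit_eq`, `dyadic_apply_ne_zero`] -/
theorem dyadic_crit_action_visc (hε : 0 < ε₀) (hW : IsEternalVisc ε₀ νh dyadicTable W) :
    ∃ M : ℝ, ∀ n : ℤ, IntegrableOn (fun t : ℝ => |(-t)⁻¹ * W n (-Real.log (-t)) 0|) (Iio 0) ∧
      ∫ t in Iio 0, |(-t)⁻¹ * W n (-Real.log (-t)) 0| ≤ M := by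
  obtain ⟨M, hM⟩ := hW.action
  refine ⟨M, fun n => ?_⟩
  have hfun : (fun t : ℝ => ‖(-t)⁻¹ • W n (-Real.log (-t))‖)
      = fun t : ℝ => |(-t)⁻¹ * W n (-Real.log (-t)) 0| := by
    funext t
    rw [norm_smul, Real.norm_eq_abs,
      norm_eq_abs_of_support_zero (fun j hj => dyadic_apply_ne_zero hε hW n hj _), abs_mul]
  have h := integral_crit_eq (W n)
  rw [hfun] at h
  exact ⟨h.1.1 (hM n).1, by rw [h.2 (hM n).1]; exact (hM n).2⟩

/-- The forward clause in critical variables, any `ν̂ ≥ 0`.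
[cite: Tao2016AveragedNS, §6.4; tree `exists_norm_crit_le`] -/
theorem dyadic_crit_bdd_visc (hε : 0 < ε₀) (hW : IsEternalVisc ε₀ νh dyadicTable W) (n : ℤ) :
    ∃ t₀ : ℝ, t₀ < 0 ∧ ∃ P : ℝ, ∀ t : ℝ, t₀ ≤ t → t < 0 → |(-t)⁻¹ * W n (-Real.log (-t)) 0| ≤ P := by
  obtain ⟨t₀, ht₀, B, hB⟩ := exists_norm_crit_le hW n
  refine ⟨t₀, ht₀, B, fun t h1 h2 => ?_⟩
  have h := hB t h1 h2
  rwa [norm_smul, Real.norm_eq_abs,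
    norm_eq_abs_of_support_zero (fun j hj => dyadic_apply_ne_zero hε hW n hj _), ← abs_mul] at h

/-- **Loudness in critical variables.**  `wtEnergy ε₀ W n σ = physWeight(1)^n V_n(t)²` at `t = -e^{-σ}`
(`physWeight(1) = (1+ε₀)^{-4}`); hence a shell loud in log-time is loud in critical time.
[cite: Tao2016AveragedNS, §4 Thm. 4.2 (statement shape), §6.4; cell vocabulary (`wtEnergy`)] -/
theorem dyadic_crit_loud (hε : 0 < ε₀) (hW : IsEternalVisc ε₀ νh dyadicTable W) {n : ℕ} {s₀ : ℝ}
    (h : ∃ σ : ℝ, s₀ < wtEnergy ε₀ W n σ) :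
    ∃ t : ℝ, t < 0 ∧ s₀ < physWeight 1 ε₀ ^ n * ((-t)⁻¹ * W n (-Real.log (-t)) 0) ^ 2 := by
  obtain ⟨σ, hσ⟩ := h
  refine ⟨-Real.exp (-σ), neg_neg_iff_pos.2 (Real.exp_pos _), ?_⟩
  have hkey : ((- -Real.exp (-σ))⁻¹ * W n (-Real.log (- -Real.exp (-σ))) 0) ^ 2
      = Real.exp (2 * σ) * ‖W n σ‖ ^ 2 := by
    rw [neg_neg, Real.log_exp, neg_neg, ← Real.exp_neg, neg_neg, mul_pow,
      norm_eq_abs_of_support_zero (fun j hj => dyadic_apply_ne_zero hε hW n hj _), sq_abs,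
      ← Real.exp_nat_mul]
    push_cast
    ring_nf
  rw [hkey]
  exact hσ

/-- **CLASSICAL FORM ⇒ `NoLoudLadder` on the dyadic member (fixed `ε₀ > 0`).**  If for every `ν̂ > 0` the viscous
chain (vKP-crit) has NO real solution on `t < 0` with uniformly integrable shells, shells bounded near `0⁻` and every
shell `n ≥ 0` loud (`sup_t physWeight(1)^n V_n(t)² ≥ ν̂²/4096`), then every uniformly bounded admissible viscous
(`ν̂ > 0`) eternal solution of `dyadicTable` that is loud on every shell is not forward (S₁)-surviving (indeed none
exists) — the dyadic slice of (ρ+) at this `ε₀`.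
[cite: Tao2016AveragedNS, §1.2, §4 Thm. 4.2 (statement shape) and the viscous equation before it, §6.4; this file] -/
theorem dyadic_noLoudLadder_of_classical (hε : 0 < ε₀)
    (hCL : ∀ νh : ℝ, 0 < νh → ¬ ∃ V : ℤ → ℝ → ℝ,
      (∀ (n : ℤ) (t : ℝ), t < 0 →
        HasDerivAt (V n) (bigLam ε₀ * V (n - 1) t ^ 2 - (bigLam ε₀)⁻¹ * (V n t * V (n + 1) t)
          - νh * (1 + ε₀) ^ ((2 : ℝ) * n) * V n t) t) ∧
      (∃ M : ℝ, ∀ n : ℤ, IntegrableOn (fun t => |V n t|) (Iio 0) ∧ ∫ t in Iio 0, |V n t| ≤ M) ∧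
      (∀ n : ℤ, ∃ t₀ : ℝ, t₀ < 0 ∧ ∃ P : ℝ, ∀ t : ℝ, t₀ ≤ t → t < 0 → |V n t| ≤ P) ∧
      (∀ (n : ℕ) (s₀ : ℝ), s₀ < νh ^ 2 / 4096 → ∃ t : ℝ, t < 0 ∧ s₀ < physWeight 1 ε₀ ^ n * V n t ^ 2)) :
    ∀ (νh : ℝ) (W : ℤ → ℝ → Em 4), 0 < νh → IsEternalVisc ε₀ νh dyadicTable W → UniformBound W →
      (∀ n₀ : ℕ, ∀ s₀ : ℝ, s₀ < νh ^ 2 / 4096 → ∃ σ : ℝ, s₀ < wtEnergy ε₀ W n₀ σ) →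
        ¬ EternalSurvivingFwd 1 ε₀ W := by
  intro νh W hν hW _ hloud _
  refine hCL νh hν ⟨fun n t => (-t)⁻¹ * W n (-Real.log (-t)) 0,
    fun n t ht => dyadic_crit_hasDerivAt_visc hW n ht, dyadic_crit_action_visc hε hW,
    fun n => dyadic_crit_bdd_visc hε hW n, fun n s₀ hs => ?_⟩
  exact dyadic_crit_loud hε hW (hloud n s₀ hs)

/-- **CLASSICAL FORM BELOW A THRESHOLD ⇒ the dyadic slice of (ρ+) `NoLoudLadderOne`** (the registered stub
`stub_noLoudLadderOne` of ⟨20419⟩ restricted to `α = dyadicTable`).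
[cite: Tao2016AveragedNS, §1.2, §4 Thm. 4.2 (statement shape), §6.4; this file] -/
theorem dyadic_noLoudLadder_slice_of_classical
    (hCL : ∃ εs : ℝ, 0 < εs ∧ ∀ ε₀ : ℝ, 0 < ε₀ → ε₀ ≤ εs → ∀ νh : ℝ, 0 < νh → ¬ ∃ V : ℤ → ℝ → ℝ,
      (∀ (n : ℤ) (t : ℝ), t < 0 →
        HasDerivAt (V n) (bigLam ε₀ * V (n - 1) t ^ 2 - (bigLam ε₀)⁻¹ * (V n t * V (n + 1) t)
          - νh * (1 + ε₀) ^ ((2 : ℝ) * n) * V n t) t) ∧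
      (∃ M : ℝ, ∀ n : ℤ, IntegrableOn (fun t => |V n t|) (Iio 0) ∧ ∫ t in Iio 0, |V n t| ≤ M) ∧
      (∀ n : ℤ, ∃ t₀ : ℝ, t₀ < 0 ∧ ∃ P : ℝ, ∀ t : ℝ, t₀ ≤ t → t < 0 → |V n t| ≤ P) ∧
      (∀ (n : ℕ) (s₀ : ℝ), s₀ < νh ^ 2 / 4096 → ∃ t : ℝ, t < 0 ∧ s₀ < physWeight 1 ε₀ ^ n * V n t ^ 2)) :
    ∃ εs : ℝ, 0 < εs ∧ ∀ ε₀ : ℝ, 0 < ε₀ → ε₀ ≤ εs →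
      ∀ (νh : ℝ) (W : ℤ → ℝ → Em 4), 0 < νh → IsEternalVisc ε₀ νh dyadicTable W → UniformBound W →
        (∀ n₀ : ℕ, ∀ s₀ : ℝ, s₀ < νh ^ 2 / 4096 → ∃ σ : ℝ, s₀ < wtEnergy ε₀ W n₀ σ) →
          ¬ EternalSurvivingFwd 1 ε₀ W := by
  obtain ⟨εs, hεs, H⟩ := hCL
  exact ⟨εs, hεs, fun ε₀ hε₀ hle => dyadic_noLoudLadder_of_classical hε₀ (H ε₀ hε₀ hle)⟩

/-- **What a prover of the viscous classical form may assume for free**: the critical scalar variable of an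
admissible viscous dyadic solution is non-negative (`dyadic_nonneg`).
[cite: Tao2016AveragedNS, §1.2, §6.4; tree `dyadic_nonneg`] -/
theorem dyadic_crit_nonneg_visc (hε : 0 < ε₀) (hW : IsEternalVisc ε₀ νh dyadicTable W) (n : ℤ) {t : ℝ}
    (ht : t < 0) : 0 ≤ (-t)⁻¹ * W n (-Real.log (-t)) 0 :=
  mul_nonneg (inv_nonneg.2 (neg_pos.2 ht).le) (dyadic_nonneg hε hW n _)

end Summit.NavierStokesRegularity.NavierStokesRegularity.Theorems.NoSurvivingEternalViscBddOne.WakeCriterion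

end
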